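import Summits.QuantumFields.YangMills.Theorems.ColdStartUniversalityLatticeLangevinCocycleRestart
import Summits.QuantumFields.YangMills.Theorems.ColdStartUniversalityLatticeLangevinFeller
import HarnessLib

/-!
# Route `ColdStartUniversality` (rung input (M), crux K_A1 stmt-QuantumFields-24809): the FLOW (COCYCLE) PROPERTY of
# the SU(2) lattice Langevin dynamics at dyadic times — the spliced process solves the SZZ system

Helper file (seat `ym-line-csu-p1`, g4).  On the canonical continuous-path space (law of a flat Brownian motion,
coordinate process), the regular solution flow `U` of `exists_regularFlow` satisfies, for every start `x`, every DYADIC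
time `s = k₀/2^{m₀}` and every `t`,

  `U x (s + t) p = U (U x s p) t (θ_s p)`   for a.e. path `p`   (`cocycle_dyadic`),

because the spliced process `X` (first leg `U x`, then the flow restarted from `U x s` with the shifted noise) is itself
a solution of the SZZ system from `x` for the raw natural filtration (`isSolution_splice`: adapted/continuous by
`…Splice`; Itô integrals of the noise coefficients along `X` exist by `exists_isItoIntegral_flatCoord` and satisfy the
integral identity — up to time `s` by `itoIntegral_splice_eq_firstLeg`, after `s` by `restartIdentity_at` on the dyadic
times and path continuity), hence indistinguishable from `U x` (`latticeLangevin_pathwise_unique`).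
No definition, no sorry.  RECORD-rung R3 plumbing; nothing here bears on the mass gap.
-/

set_option autoImplicit false

noncomputable section

namespace Summit.QuantumFields.YangMills.Theorems.ColdStartUniversality

open MeasureTheory ProbabilityTheory Filter Topology Finset
open scoped NNReal ENNReal BigOperators
open Literature Literature.Probability.Process Literature.MathematicalPhysics.QuantumFieldTheory
open Literature.MathematicalPhysics.QuantumLattice (fundamentalRep fundamentalLatticeRep continuous_fundamentalRep)

variable {Ω : Type} [MeasurableSpace Ω] {P : Measure Ω} [IsProbabilityMeasure P] {L : ℕ} [NeZero L]
  {W : ℝ≥0 → Ω → (Edge 3 L × NoiseIdx 2 → ℝ)}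

/-- **Itô integrals of the noise coefficients along the spliced process exist** (real and imaginary parts: bounded
progressive integrands against the coordinate Brownian motions). [folklore] -/
theorem exists_spliceItoIntegrals (hW : IsFlatBrownian W P) (β : ℝ)
    (U : GaugeConfig 3 L (Matrix.specialUnitaryGroup (Fin 2) ℂ) → ℝ≥0 →
      {p : ℝ≥0 → (Edge 3 L × NoiseIdx 2 → ℝ) // Continuous p ∧ p 0 = 0} →
      GaugeConfig 3 L (Matrix.specialUnitaryGroup (Fin 2) ℂ))
    (hprog : ∀ i : ℝ≥0, Measurable[@Prod.instMeasurableSpace (Set.Iic i)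
        (GaugeConfig 3 L (Matrix.specialUnitaryGroup (Fin 2) ℂ) ×
          {p : ℝ≥0 → (Edge 3 L × NoiseIdx 2 → ℝ) // Continuous p ∧ p 0 = 0}) inferInstance
        (@Prod.instMeasurableSpace (GaugeConfig 3 L (Matrix.specialUnitaryGroup (Fin 2) ℂ))
          {p : ℝ≥0 → (Edge 3 L × NoiseIdx 2 → ℝ) // Continuous p ∧ p 0 = 0} inferInstance
          ((isFlatBrownian_canonical hW).natFiltration i))]
      (fun q : Set.Iic i × (GaugeConfig 3 L (Matrix.specialUnitaryGroup (Fin 2) ℂ) ×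
        {p : ℝ≥0 → (Edge 3 L × NoiseIdx 2 → ℝ) // Continuous p ∧ p 0 = 0}) => U q.2.1 q.1 q.2.2))
    (x : GaugeConfig 3 L (Matrix.specialUnitaryGroup (Fin 2) ℂ)) (k₀ m₀ : ℕ) :
    ∃ K : Edge 3 L → NoiseIdx 2 → Fin 2 → Fin 2 → ℝ≥0 → {p : ℝ≥0 → (Edge 3 L × NoiseIdx 2 → ℝ) // Continuous p ∧ p 0 = 0} → ℂ,
      ∀ e n i j, IsItoIntegralC (fun u p => (latticeLangevinDynamics (fundamentalLatticeRep 2) β).noise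
        (matrixConfig (fundamentalRep (Fin 2)) (if u ≤ (k₀ : ℝ≥0) / 2 ^ m₀ then U x u p else
          U (U x ((k₀ : ℝ≥0) / 2 ^ m₀) p) (u - (k₀ : ℝ≥0) / 2 ^ m₀)
            ⟨fun v => p.1 ((k₀ : ℝ≥0) / 2 ^ m₀ + v) - p.1 ((k₀ : ℝ≥0) / 2 ^ m₀),
              continuous_shiftPath_and_zero (isFlatBrownian_canonical hW) ((k₀ : ℝ≥0) / 2 ^ m₀) p⟩)) e n i j)
      (fun u (p : {p : ℝ≥0 → (Edge 3 L × NoiseIdx 2 → ℝ) // Continuous p ∧ p 0 = 0}) => p.1 u (e, n)) (K e n i j)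
      (isFlatBrownian_canonical hW).natFiltration
      (P.map (fun ω => (⟨fun t => W t ω, continuous_path_and_zero hW ω⟩ :
        {p : ℝ≥0 → (Edge 3 L × NoiseIdx 2 → ℝ) // Continuous p ∧ p 0 = 0}))) := by
  haveI := secondCountableTopology_su2
  haveI := borelSpace_config L
  haveI : IsProbabilityMeasure (P.map (fun ω => (⟨fun t => W t ω, continuous_path_and_zero hW ω⟩ :
        {p : ℝ≥0 → (Edge 3 L × NoiseIdx 2 → ℝ) // Continuous p ∧ p 0 = 0}))) :=
    Measure.isProbabilityMeasure_map (measurable_pathMap hW).aemeasurable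
  have hWc := isFlatBrownian_canonical hW
  set s : ℝ≥0 := (k₀ : ℝ≥0) / 2 ^ m₀ with hs
  have hprogX := measurable_splice_prog hW U hprog x s
  have hex : ∀ (e : Edge 3 L) (n : NoiseIdx 2) (i j : Fin 2) (c : ℂ →L[ℝ] ℝ),
      ∃ Kc : ℝ≥0 → {p : ℝ≥0 → (Edge 3 L × NoiseIdx 2 → ℝ) // Continuous p ∧ p 0 = 0} → ℝ,
        IsItoIntegral (fun u p => c ((latticeLangevinDynamics (fundamentalLatticeRep 2) β).noise
          (matrixConfig (fundamentalRep (Fin 2)) (if u ≤ s then U x u p else U (U x s p) (u - s)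
            ⟨fun v => p.1 (s + v) - p.1 s, continuous_shiftPath_and_zero hWc s p⟩)) e n i j))
          (fun u (p : {p : ℝ≥0 → (Edge 3 L × NoiseIdx 2 → ℝ) // Continuous p ∧ p 0 = 0}) => p.1 u (e, n)) Kc
          hWc.natFiltration (P.map (fun ω => (⟨fun t => W t ω, continuous_path_and_zero hW ω⟩ :
        {p : ℝ≥0 → (Edge 3 L × NoiseIdx 2 → ℝ) // Continuous p ∧ p 0 = 0}))) := by
    intro e n i j c
    have hcm : Continuous fun V : GaugeConfig 3 L (Matrix.specialUnitaryGroup (Fin 2) ℂ) =>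
        c ((latticeLangevinDynamics (fundamentalLatticeRep 2) β).noise (matrixConfig (fundamentalRep (Fin 2)) V) e n i j) :=
      c.continuous.comp (continuous_noise_entry β e n i j)
    obtain ⟨C, -, hC⟩ := exists_abs_le_of_continuous hcm
    have hprogH : IsStronglyProgressive hWc.natFiltration (fun u (p : {p : ℝ≥0 → (Edge 3 L × NoiseIdx 2 → ℝ) // Continuous p ∧ p 0 = 0}) =>
        c ((latticeLangevinDynamics (fundamentalLatticeRep 2) β).noise (matrixConfig (fundamentalRep (Fin 2))
          (if u ≤ s then U x u p else U (U x s p) (u - s)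
            ⟨fun v => p.1 (s + v) - p.1 s, continuous_shiftPath_and_zero hWc s p⟩)) e n i j)) := by
      intro i₀
      exact stronglyMeasurable_real_of_measurable (hcm.measurable.comp (hprogX i₀))
    obtain ⟨Kc, hKc, -, -⟩ := exists_isItoIntegral_flatCoord hWc (e, n) hprogH
      (fun t => sqErr_zero_ne_top_of_ae_abs_le (C := C) (Eventually.of_forall fun p u => hC _) t)
    exact ⟨Kc, hKc⟩
  choose Kre hKre using fun e n i j => hex e n i j Complex.reCLM
  choose Kim hKim using fun e n i j => hex e n i j Complex.imCLM
  exact ⟨fun e n i j u p => (⟨Kre e n i j u p, Kim e n i j u p⟩ : ℂ), fun e n i j => ⟨hKre e n i j, hKim e n i j⟩⟩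

/-- **The restart identity at ALL times after the dyadic splicing time** (from the dyadic times `b/2^a` by continuity of
both sides). [folklore] -/
theorem restartIdentity_all (hW : IsFlatBrownian W P) (β : ℝ)
    (U : GaugeConfig 3 L (Matrix.specialUnitaryGroup (Fin 2) ℂ) → ℝ≥0 →
      {p : ℝ≥0 → (Edge 3 L × NoiseIdx 2 → ℝ) // Continuous p ∧ p 0 = 0} →
      GaugeConfig 3 L (Matrix.specialUnitaryGroup (Fin 2) ℂ))
    (hU0 : ∀ y p, U y 0 p = y)
    (hprog : ∀ i : ℝ≥0, Measurable[@Prod.instMeasurableSpace (Set.Iic i)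
        (GaugeConfig 3 L (Matrix.specialUnitaryGroup (Fin 2) ℂ) ×
          {p : ℝ≥0 → (Edge 3 L × NoiseIdx 2 → ℝ) // Continuous p ∧ p 0 = 0}) inferInstance
        (@Prod.instMeasurableSpace (GaugeConfig 3 L (Matrix.specialUnitaryGroup (Fin 2) ℂ))
          {p : ℝ≥0 → (Edge 3 L × NoiseIdx 2 → ℝ) // Continuous p ∧ p 0 = 0} inferInstance
          ((isFlatBrownian_canonical hW).natFiltration i))]
      (fun q : Set.Iic i × (GaugeConfig 3 L (Matrix.specialUnitaryGroup (Fin 2) ℂ) ×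
        {p : ℝ≥0 → (Edge 3 L × NoiseIdx 2 → ℝ) // Continuous p ∧ p 0 = 0}) => U q.2.1 q.1 q.2.2))
    {G : Set (GaugeConfig 3 L (Matrix.specialUnitaryGroup (Fin 2) ℂ) ×
      {p : ℝ≥0 → (Edge 3 L × NoiseIdx 2 → ℝ) // Continuous p ∧ p 0 = 0})} (hGm : MeasurableSet G)
    (hGc : ∀ q ∈ G, Continuous fun r => U q.1 r q.2)
    (hGae : ∀ y, ∀ᵐ q ∂(P.map (fun ω => (⟨fun t => W t ω, continuous_path_and_zero hW ω⟩ :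
        {p : ℝ≥0 → (Edge 3 L × NoiseIdx 2 → ℝ) // Continuous p ∧ p 0 = 0}))), (y, q) ∈ G)
    (hsol : ∀ y, (latticeLangevinDynamics (fundamentalLatticeRep 2) β).IsSolution (fundamentalRep (Fin 2))
      (isFlatBrownian_canonical hW).natFiltration
      (P.map (fun ω => (⟨fun t => W t ω, continuous_path_and_zero hW ω⟩ :
        {p : ℝ≥0 → (Edge 3 L × NoiseIdx 2 → ℝ) // Continuous p ∧ p 0 = 0})))
      (fun (t : ℝ≥0) (p : {p : ℝ≥0 → (Edge 3 L × NoiseIdx 2 → ℝ) // Continuous p ∧ p 0 = 0}) => p.1 t) (U y))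
    (x : GaugeConfig 3 L (Matrix.specialUnitaryGroup (Fin 2) ℂ)) (k₀ m₀ : ℕ)
    {K : Edge 3 L → NoiseIdx 2 → Fin 2 → Fin 2 → ℝ≥0 → {p : ℝ≥0 → (Edge 3 L × NoiseIdx 2 → ℝ) // Continuous p ∧ p 0 = 0} → ℂ}
    (hK : ∀ e n i j, IsItoIntegralC (fun u p => (latticeLangevinDynamics (fundamentalLatticeRep 2) β).noise
        (matrixConfig (fundamentalRep (Fin 2)) (if u ≤ (k₀ : ℝ≥0) / 2 ^ m₀ then U x u p else
          U (U x ((k₀ : ℝ≥0) / 2 ^ m₀) p) (u - (k₀ : ℝ≥0) / 2 ^ m₀)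
            ⟨fun v => p.1 ((k₀ : ℝ≥0) / 2 ^ m₀ + v) - p.1 ((k₀ : ℝ≥0) / 2 ^ m₀),
              continuous_shiftPath_and_zero (isFlatBrownian_canonical hW) ((k₀ : ℝ≥0) / 2 ^ m₀) p⟩)) e n i j)
      (fun u (p : {p : ℝ≥0 → (Edge 3 L × NoiseIdx 2 → ℝ) // Continuous p ∧ p 0 = 0}) => p.1 u (e, n)) (K e n i j)
      (isFlatBrownian_canonical hW).natFiltration
      (P.map (fun ω => (⟨fun t => W t ω, continuous_path_and_zero hW ω⟩ :
        {p : ℝ≥0 → (Edge 3 L × NoiseIdx 2 → ℝ) // Continuous p ∧ p 0 = 0})))) :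
    ∀ᵐ p ∂(P.map (fun ω => (⟨fun t => W t ω, continuous_path_and_zero hW ω⟩ :
        {p : ℝ≥0 → (Edge 3 L × NoiseIdx 2 → ℝ) // Continuous p ∧ p 0 = 0}))),
      ∀ (e : Edge 3 L) (i j : Fin 2) (r : ℝ≥0),
        ((fundamentalRep (Fin 2) (U (U x ((k₀ : ℝ≥0) / 2 ^ m₀) p) r ⟨fun v => p.1 ((k₀ : ℝ≥0) / 2 ^ m₀ + v) - p.1 ((k₀ : ℝ≥0) / 2 ^ m₀),
              continuous_shiftPath_and_zero (isFlatBrownian_canonical hW) ((k₀ : ℝ≥0) / 2 ^ m₀) p⟩ e) : Matrix (Fin 2) (Fin 2) ℂ) i j -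
          (fundamentalRep (Fin 2) (U x ((k₀ : ℝ≥0) / 2 ^ m₀) p e) : Matrix (Fin 2) (Fin 2) ℂ) i j -
          ∫ v in (0 : ℝ)..(r : ℝ), (latticeLangevinDynamics (fundamentalLatticeRep 2) β).drift
            (matrixConfig (fundamentalRep (Fin 2)) (U (U x ((k₀ : ℝ≥0) / 2 ^ m₀) p) v.toNNReal
              ⟨fun v => p.1 ((k₀ : ℝ≥0) / 2 ^ m₀ + v) - p.1 ((k₀ : ℝ≥0) / 2 ^ m₀),
              continuous_shiftPath_and_zero (isFlatBrownian_canonical hW) ((k₀ : ℝ≥0) / 2 ^ m₀) p⟩)) e i j) =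
        ∑ n : NoiseIdx 2, (K e n i j ((k₀ : ℝ≥0) / 2 ^ m₀ + r) p - K e n i j ((k₀ : ℝ≥0) / 2 ^ m₀) p) := by
  haveI := secondCountableTopology_su2
  haveI := borelSpace_config L
  haveI : IsProbabilityMeasure (P.map (fun ω => (⟨fun t => W t ω, continuous_path_and_zero hW ω⟩ :
        {p : ℝ≥0 → (Edge 3 L × NoiseIdx 2 → ℝ) // Continuous p ∧ p 0 = 0}))) :=
    Measure.isProbabilityMeasure_map (measurable_pathMap hW).aemeasurable
  have hWc := isFlatBrownian_canonical hW
  set s : ℝ≥0 := (k₀ : ℝ≥0) / 2 ^ m₀ with hs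
  -- dyadic times
  have hrestart : ∀ᵐ p ∂(P.map (fun ω => (⟨fun t => W t ω, continuous_path_and_zero hW ω⟩ :
        {p : ℝ≥0 → (Edge 3 L × NoiseIdx 2 → ℝ) // Continuous p ∧ p 0 = 0}))),
      ∀ (e : Edge 3 L) (i j : Fin 2) (a b : ℕ),
        ((fundamentalRep (Fin 2) (U (U x s p) (((b : ℕ) : ℝ≥0) / 2 ^ a) ⟨fun v => p.1 (s + v) - p.1 s,
            continuous_shiftPath_and_zero hWc s p⟩ e) : Matrix (Fin 2) (Fin 2) ℂ) i j -
          (fundamentalRep (Fin 2) (U x s p e) : Matrix (Fin 2) (Fin 2) ℂ) i j -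
          ∫ v in (0 : ℝ)..(((b : ℕ) : ℝ≥0) / 2 ^ a : ℝ≥0), (latticeLangevinDynamics (fundamentalLatticeRep 2) β).drift
            (matrixConfig (fundamentalRep (Fin 2)) (U (U x s p) v.toNNReal
              ⟨fun v => p.1 (s + v) - p.1 s, continuous_shiftPath_and_zero hWc s p⟩)) e i j) =
        ∑ n : NoiseIdx 2, (K e n i j (s + ((b : ℕ) : ℝ≥0) / 2 ^ a) p - K e n i j s p) := by
    refine ae_all_iff.2 fun e => ae_all_iff.2 fun i => ae_all_iff.2 fun j => ae_all_iff.2 fun a =>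
      ae_all_iff.2 fun b => ?_
    exact restartIdentity_at hW β U hU0 hprog hGm hGc hGae hsol x k₀ m₀ e i j (fun n => hK e n i j) _
  -- continuity of the paths of `K`
  have hKc : ∀ᵐ p ∂(P.map (fun ω => (⟨fun t => W t ω, continuous_path_and_zero hW ω⟩ :
        {p : ℝ≥0 → (Edge 3 L × NoiseIdx 2 → ℝ) // Continuous p ∧ p 0 = 0}))),
      ∀ (e : Edge 3 L) (n : NoiseIdx 2) (i j : Fin 2), Continuous fun u => K e n i j u p := by
    refine ae_all_iff.2 fun e => ae_all_iff.2 fun n => ae_all_iff.2 fun i => ae_all_iff.2 fun j => ?_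
    filter_upwards [(hK e n i j).1.continuous, (hK e n i j).2.continuous] with p h1 h2
    have h : Continuous fun u => (((K e n i j u p).re : ℝ) : ℂ) + (((K e n i j u p).im : ℝ) : ℂ) * Complex.I :=
      (Complex.continuous_ofReal.comp h1).add ((Complex.continuous_ofReal.comp h2).mul continuous_const)
    refine h.congr fun u => ?_
    exact Complex.ext (by simp) (by simp)
  -- second-leg continuity certificate
  have hYs : Measurable[hWc.natFiltration s] (U x s) := measurable_flow_at hW U hprog x s
  have hfull : ∀ y, (P.map (fun ω => (⟨fun t => W t ω, continuous_path_and_zero hW ω⟩ :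
        {p : ℝ≥0 → (Edge 3 L × NoiseIdx 2 → ℝ) // Continuous p ∧ p 0 = 0}))) (Prod.mk y ⁻¹' G) = 1 := by
    intro y
    rw [← prob_compl_eq_zero_iff (measurable_prodMk_left hGm)]
    exact ae_iff.1 (hGae y)
  have hsec := ae_mem_of_forall_prob_eq_one hW s hYs hGm hfull
  have hdc := fun (e : Edge 3 L) (i j : Fin 2) => continuous_drift_entry (L := L) β e i j
  filter_upwards [hrestart, hKc, hsec] with p hp2 hp3 hp4
  intro e i j r
  have h2c : Continuous fun r : ℝ≥0 => U (U x s p) r ⟨fun v => p.1 (s + v) - p.1 s,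
      continuous_shiftPath_and_zero hWc s p⟩ := hGc _ hp4
  set Φf : ℝ≥0 → ℂ := fun r =>
      (fundamentalRep (Fin 2) (U (U x s p) r ⟨fun v => p.1 (s + v) - p.1 s,
        continuous_shiftPath_and_zero hWc s p⟩ e) : Matrix (Fin 2) (Fin 2) ℂ) i j -
      (fundamentalRep (Fin 2) (U x s p e) : Matrix (Fin 2) (Fin 2) ℂ) i j -
      ∫ v in (0 : ℝ)..(r : ℝ), (latticeLangevinDynamics (fundamentalLatticeRep 2) β).drift
        (matrixConfig (fundamentalRep (Fin 2)) (U (U x s p) v.toNNReal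
          ⟨fun v => p.1 (s + v) - p.1 s, continuous_shiftPath_and_zero hWc s p⟩)) e i j with hΦf
  set Ψf : ℝ≥0 → ℂ := fun r => ∑ n : NoiseIdx 2, (K e n i j (s + r) p - K e n i j s p) with hΨf
  have hint : ∀ a b : ℝ, IntervalIntegrable (fun v : ℝ =>
      (latticeLangevinDynamics (fundamentalLatticeRep 2) β).drift (matrixConfig (fundamentalRep (Fin 2))
        (U (U x s p) v.toNNReal ⟨fun v => p.1 (s + v) - p.1 s, continuous_shiftPath_and_zero hWc s p⟩)) e i j)
      volume a b := fun a b => ((hdc e i j).comp (h2c.comp continuous_real_toNNReal)).intervalIntegrable a b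
  have hV : Continuous fun r : ℝ≥0 => (fundamentalRep (Fin 2) (U (U x s p) r ⟨fun v => p.1 (s + v) - p.1 s,
      continuous_shiftPath_and_zero hWc s p⟩ e) : Matrix (Fin 2) (Fin 2) ℂ) :=
    (continuous_fundamentalRep (Fin 2)).comp ((continuous_apply e).comp h2c)
  have hL1 := hV.matrix_elem i j
  have hL3 : Continuous fun r : ℝ≥0 => ∫ v in (0 : ℝ)..(r : ℝ), (latticeLangevinDynamics (fundamentalLatticeRep 2) β).drift
      (matrixConfig (fundamentalRep (Fin 2)) (U (U x s p) v.toNNReal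
        ⟨fun v => p.1 (s + v) - p.1 s, continuous_shiftPath_and_zero hWc s p⟩)) e i j :=
    (intervalIntegral.continuous_primitive hint 0).comp NNReal.continuous_coe
  have hL : Continuous Φf := (hL1.sub continuous_const).sub hL3
  have hR : Continuous Ψf :=
    continuous_finsetSum _ fun n _ => ((hp3 e n i j).comp (continuous_const.add continuous_id)).sub continuous_const
  have hD : ∀ m : ℕ, Φf (sampleLeft m r) = Ψf (sampleLeft m r) := fun m => hp2 e i j m (⌈(r : ℝ) * 2 ^ m⌉₊ - 1)
  have hlimL := (hL.tendsto r).comp (tendsto_sampleLeft r)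
  have hlimR := (hR.tendsto r).comp (tendsto_sampleLeft r)
  have hfun : (Φf ∘ fun m => sampleLeft m r) = (Ψf ∘ fun m => sampleLeft m r) := funext fun m => hD m
  rw [hfun] at hlimL
  exact tendsto_nhds_unique hlimL hlimR

/-- **The integral identity of the SZZ system along the spliced process** (first leg: the identity of `U x` with the
identified Itô integrals; second leg: the restart identity). [folklore] -/
theorem spliceIdentity (hW : IsFlatBrownian W P) (β : ℝ)
    (U : GaugeConfig 3 L (Matrix.specialUnitaryGroup (Fin 2) ℂ) → ℝ≥0 →
      {p : ℝ≥0 → (Edge 3 L × NoiseIdx 2 → ℝ) // Continuous p ∧ p 0 = 0} →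
      GaugeConfig 3 L (Matrix.specialUnitaryGroup (Fin 2) ℂ))
    (hU0 : ∀ y p, U y 0 p = y)
    (hprog : ∀ i : ℝ≥0, Measurable[@Prod.instMeasurableSpace (Set.Iic i)
        (GaugeConfig 3 L (Matrix.specialUnitaryGroup (Fin 2) ℂ) ×
          {p : ℝ≥0 → (Edge 3 L × NoiseIdx 2 → ℝ) // Continuous p ∧ p 0 = 0}) inferInstance
        (@Prod.instMeasurableSpace (GaugeConfig 3 L (Matrix.specialUnitaryGroup (Fin 2) ℂ))
          {p : ℝ≥0 → (Edge 3 L × NoiseIdx 2 → ℝ) // Continuous p ∧ p 0 = 0} inferInstance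
          ((isFlatBrownian_canonical hW).natFiltration i))]
      (fun q : Set.Iic i × (GaugeConfig 3 L (Matrix.specialUnitaryGroup (Fin 2) ℂ) ×
        {p : ℝ≥0 → (Edge 3 L × NoiseIdx 2 → ℝ) // Continuous p ∧ p 0 = 0}) => U q.2.1 q.1 q.2.2))
    {G : Set (GaugeConfig 3 L (Matrix.specialUnitaryGroup (Fin 2) ℂ) ×
      {p : ℝ≥0 → (Edge 3 L × NoiseIdx 2 → ℝ) // Continuous p ∧ p 0 = 0})} (hGm : MeasurableSet G)
    (hGc : ∀ q ∈ G, Continuous fun r => U q.1 r q.2)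
    (hGae : ∀ y, ∀ᵐ q ∂(P.map (fun ω => (⟨fun t => W t ω, continuous_path_and_zero hW ω⟩ :
        {p : ℝ≥0 → (Edge 3 L × NoiseIdx 2 → ℝ) // Continuous p ∧ p 0 = 0}))), (y, q) ∈ G)
    (hsol : ∀ y, (latticeLangevinDynamics (fundamentalLatticeRep 2) β).IsSolution (fundamentalRep (Fin 2))
      (isFlatBrownian_canonical hW).natFiltration
      (P.map (fun ω => (⟨fun t => W t ω, continuous_path_and_zero hW ω⟩ :
        {p : ℝ≥0 → (Edge 3 L × NoiseIdx 2 → ℝ) // Continuous p ∧ p 0 = 0})))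
      (fun (t : ℝ≥0) (p : {p : ℝ≥0 → (Edge 3 L × NoiseIdx 2 → ℝ) // Continuous p ∧ p 0 = 0}) => p.1 t) (U y))
    (x : GaugeConfig 3 L (Matrix.specialUnitaryGroup (Fin 2) ℂ)) (k₀ m₀ : ℕ)
    {K : Edge 3 L → NoiseIdx 2 → Fin 2 → Fin 2 → ℝ≥0 → {p : ℝ≥0 → (Edge 3 L × NoiseIdx 2 → ℝ) // Continuous p ∧ p 0 = 0} → ℂ}
    (hK : ∀ e n i j, IsItoIntegralC (fun u p => (latticeLangevinDynamics (fundamentalLatticeRep 2) β).noise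
        (matrixConfig (fundamentalRep (Fin 2)) (if u ≤ (k₀ : ℝ≥0) / 2 ^ m₀ then U x u p else
          U (U x ((k₀ : ℝ≥0) / 2 ^ m₀) p) (u - (k₀ : ℝ≥0) / 2 ^ m₀)
            ⟨fun v => p.1 ((k₀ : ℝ≥0) / 2 ^ m₀ + v) - p.1 ((k₀ : ℝ≥0) / 2 ^ m₀),
              continuous_shiftPath_and_zero (isFlatBrownian_canonical hW) ((k₀ : ℝ≥0) / 2 ^ m₀) p⟩)) e n i j)
      (fun u (p : {p : ℝ≥0 → (Edge 3 L × NoiseIdx 2 → ℝ) // Continuous p ∧ p 0 = 0}) => p.1 u (e, n)) (K e n i j)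
      (isFlatBrownian_canonical hW).natFiltration
      (P.map (fun ω => (⟨fun t => W t ω, continuous_path_and_zero hW ω⟩ :
        {p : ℝ≥0 → (Edge 3 L × NoiseIdx 2 → ℝ) // Continuous p ∧ p 0 = 0})))) :
    ∀ᵐ p ∂(P.map (fun ω => (⟨fun t => W t ω, continuous_path_and_zero hW ω⟩ :
        {p : ℝ≥0 → (Edge 3 L × NoiseIdx 2 → ℝ) // Continuous p ∧ p 0 = 0}))),
      ∀ (u : ℝ≥0) (e : Edge 3 L) (i j : Fin 2),
        (fundamentalRep (Fin 2) ((if u ≤ (k₀ : ℝ≥0) / 2 ^ m₀ then U x u p else U (U x ((k₀ : ℝ≥0) / 2 ^ m₀) p) (u - (k₀ : ℝ≥0) / 2 ^ m₀)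
        ⟨fun v => p.1 ((k₀ : ℝ≥0) / 2 ^ m₀ + v) - p.1 ((k₀ : ℝ≥0) / 2 ^ m₀),
          continuous_shiftPath_and_zero (isFlatBrownian_canonical hW) ((k₀ : ℝ≥0) / 2 ^ m₀) p⟩) e) : Matrix (Fin 2) (Fin 2) ℂ) i j =
          (fundamentalRep (Fin 2) ((if (0 : ℝ≥0) ≤ (k₀ : ℝ≥0) / 2 ^ m₀ then U x (0 : ℝ≥0) p else U (U x ((k₀ : ℝ≥0) / 2 ^ m₀) p) ((0 : ℝ≥0) - (k₀ : ℝ≥0) / 2 ^ m₀)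
        ⟨fun v => p.1 ((k₀ : ℝ≥0) / 2 ^ m₀ + v) - p.1 ((k₀ : ℝ≥0) / 2 ^ m₀),
          continuous_shiftPath_and_zero (isFlatBrownian_canonical hW) ((k₀ : ℝ≥0) / 2 ^ m₀) p⟩) e) : Matrix (Fin 2) (Fin 2) ℂ) i j +
          (∫ v in (0 : ℝ)..(u : ℝ), (latticeLangevinDynamics (fundamentalLatticeRep 2) β).drift
            (matrixConfig (fundamentalRep (Fin 2)) (if v.toNNReal ≤ (k₀ : ℝ≥0) / 2 ^ m₀ then U x v.toNNReal p else U (U x ((k₀ : ℝ≥0) / 2 ^ m₀) p) (v.toNNReal - (k₀ : ℝ≥0) / 2 ^ m₀)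
        ⟨fun v => p.1 ((k₀ : ℝ≥0) / 2 ^ m₀ + v) - p.1 ((k₀ : ℝ≥0) / 2 ^ m₀),
          continuous_shiftPath_and_zero (isFlatBrownian_canonical hW) ((k₀ : ℝ≥0) / 2 ^ m₀) p⟩)) e i j) +
          ∑ n : NoiseIdx 2, K e n i j u p := by
  haveI := secondCountableTopology_su2
  haveI := borelSpace_config L
  haveI : IsProbabilityMeasure (P.map (fun ω => (⟨fun t => W t ω, continuous_path_and_zero hW ω⟩ :
        {p : ℝ≥0 → (Edge 3 L × NoiseIdx 2 → ℝ) // Continuous p ∧ p 0 = 0}))) :=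
    Measure.isProbabilityMeasure_map (measurable_pathMap hW).aemeasurable
  have hWc := isFlatBrownian_canonical hW
  set s : ℝ≥0 := (k₀ : ℝ≥0) / 2 ^ m₀ with hs
  have hcX := ae_continuous_splice hW U hU0 hprog hGm hGc hGae x s
  obtain ⟨J1, hJ1, hid1⟩ := (hsol x).exists_ito
  have hfirst : ∀ᵐ p ∂(P.map (fun ω => (⟨fun t => W t ω, continuous_path_and_zero hW ω⟩ :
        {p : ℝ≥0 → (Edge 3 L × NoiseIdx 2 → ℝ) // Continuous p ∧ p 0 = 0}))),
      ∀ (e : Edge 3 L) (n : NoiseIdx 2) (i j : Fin 2) (u : ℝ≥0), u ≤ s → K e n i j u p = J1 e n i j u p := by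
    refine ae_all_iff.2 fun e => ae_all_iff.2 fun n => ae_all_iff.2 fun i => ae_all_iff.2 fun j => ?_
    filter_upwards [itoIntegral_splice_eq_firstLeg hW β U hU0 hprog hGm hGc hGae x s e n i j (hJ1 e n i j) (hK e n i j)]
      with p hp u hu using hp u hu
  have hrest := restartIdentity_all hW β U hU0 hprog hGm hGc hGae hsol x k₀ m₀ hK
  rw [← hs] at hrest
  have hdc := fun (e : Edge 3 L) (i j : Fin 2) => continuous_drift_entry (L := L) β e i j
  filter_upwards [hfirst, hrest, hid1, hcX] with p hp1 hp2 hp5 hp6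
  -- the first-leg identity, retyped
  have hid1' : ∀ (t : ℝ≥0) (e : Edge 3 L) (i j : Fin 2),
      (fundamentalRep (Fin 2) (U x t p e) : Matrix (Fin 2) (Fin 2) ℂ) i j =
        (fundamentalRep (Fin 2) (U x 0 p e) : Matrix (Fin 2) (Fin 2) ℂ) i j +
        (∫ v in (0 : ℝ)..(t : ℝ), (latticeLangevinDynamics (fundamentalLatticeRep 2) β).drift
          (matrixConfig (fundamentalRep (Fin 2)) (U x v.toNNReal p)) e i j) +
        ∑ n : NoiseIdx 2, J1 e n i j t p := fun t e i j => hp5 t e i j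
  have hIX : ∀ (e : Edge 3 L) (i j : Fin 2) (a b : ℝ), IntervalIntegrable (fun v : ℝ =>
      (latticeLangevinDynamics (fundamentalLatticeRep 2) β).drift (matrixConfig (fundamentalRep (Fin 2))
        (if v.toNNReal ≤ s then U x v.toNNReal p else U (U x s p) (v.toNNReal - s)
          ⟨fun v => p.1 (s + v) - p.1 s, continuous_shiftPath_and_zero hWc s p⟩)) e i j) volume a b :=
    fun e i j a b => ((hdc e i j).comp (hp6.comp continuous_real_toNNReal)).intervalIntegrable a b
  -- the first-leg integral and Itô sums in spliced form, for `t ≤ s`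
  have hlegI : ∀ (t : ℝ≥0), t ≤ s → ∀ (e : Edge 3 L) (i j : Fin 2),
      (∫ v in (0 : ℝ)..(t : ℝ), (latticeLangevinDynamics (fundamentalLatticeRep 2) β).drift
          (matrixConfig (fundamentalRep (Fin 2)) (U x v.toNNReal p)) e i j) =
        ∫ v in (0 : ℝ)..(t : ℝ), (latticeLangevinDynamics (fundamentalLatticeRep 2) β).drift
          (matrixConfig (fundamentalRep (Fin 2)) (if v.toNNReal ≤ s then U x v.toNNReal p else U (U x s p)
            (v.toNNReal - s) ⟨fun v => p.1 (s + v) - p.1 s, continuous_shiftPath_and_zero hWc s p⟩)) e i j := by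
    intro t ht e i j
    refine intervalIntegral.integral_congr fun v hv => ?_
    have hv' : v.toNNReal ≤ s := by
      rw [Set.uIcc_of_le (by exact_mod_cast (zero_le : (0 : ℝ≥0) ≤ t))] at hv
      exact le_trans (Real.toNNReal_le_iff_le_coe.2 hv.2) ht
    simp only [if_pos hv']
  have hlegS : ∀ (t : ℝ≥0), t ≤ s → ∀ (e : Edge 3 L) (i j : Fin 2),
      ∑ n : NoiseIdx 2, J1 e n i j t p = ∑ n : NoiseIdx 2, K e n i j t p :=
    fun t ht e i j => Finset.sum_congr rfl fun n _ => (hp1 e n i j t ht).symm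
  intro u e i j
  by_cases hu : u ≤ s
  · -- first leg
    simp only [if_pos hu, if_pos (zero_le : (0 : ℝ≥0) ≤ s)]
    linear_combination hid1' u e i j + hlegI u hu e i j + hlegS u hu e i j
  · -- second leg: `u = s + (u - s)`
    have hsu : s + (u - s) = u := add_tsub_cancel_of_le (le_of_not_ge hu)
    have h2 := hp2 e i j (u - s)
    rw [hsu, Finset.sum_sub_distrib] at h2
    simp only [if_neg hu, if_pos (zero_le : (0 : ℝ≥0) ≤ s)]
    have hshiftInt : (∫ v in (s : ℝ)..(u : ℝ), (latticeLangevinDynamics (fundamentalLatticeRep 2) β).drift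
          (matrixConfig (fundamentalRep (Fin 2)) (if v.toNNReal ≤ s then U x v.toNNReal p else U (U x s p)
            (v.toNNReal - s) ⟨fun v => p.1 (s + v) - p.1 s, continuous_shiftPath_and_zero hWc s p⟩)) e i j) =
        ∫ v in (0 : ℝ)..((u - s : ℝ≥0) : ℝ), (latticeLangevinDynamics (fundamentalLatticeRep 2) β).drift
          (matrixConfig (fundamentalRep (Fin 2)) (U (U x s p) v.toNNReal
            ⟨fun v => p.1 (s + v) - p.1 s, continuous_shiftPath_and_zero hWc s p⟩)) e i j := by
      have hus : (u : ℝ) = ((u - s : ℝ≥0) : ℝ) + s := by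
        rw [NNReal.coe_sub (le_of_not_ge hu)]; ring
      have hcomp := intervalIntegral.integral_comp_add_right (a := 0) (b := ((u - s : ℝ≥0) : ℝ))
        (fun v : ℝ => (latticeLangevinDynamics (fundamentalLatticeRep 2) β).drift
          (matrixConfig (fundamentalRep (Fin 2)) (if v.toNNReal ≤ s then U x v.toNNReal p else U (U x s p)
            (v.toNNReal - s) ⟨fun v => p.1 (s + v) - p.1 s, continuous_shiftPath_and_zero hWc s p⟩)) e i j) (s : ℝ)
      rw [zero_add] at hcomp
      rw [hus, ← hcomp]
      refine intervalIntegral.integral_congr fun v hv => ?_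
      rw [Set.uIcc_of_le (by exact_mod_cast (zero_le : (0 : ℝ≥0) ≤ u - s))] at hv
      have hv0 : 0 ≤ v := hv.1
      have hvs : (v + s).toNNReal = s + v.toNNReal := by
        rw [Real.toNNReal_add hv0 (NNReal.coe_nonneg s), Real.toNNReal_coe, add_comm]
      simp only [hvs]
      rw [splice_add hW U hU0 x s v.toNNReal p]
    have hadj := intervalIntegral.integral_add_adjacent_intervals (hIX e i j 0 s) (hIX e i j s u)
    linear_combination h2 + hid1' s e i j + hlegI s le_rfl e i j + hlegS s le_rfl e i j + hadj - hshiftInt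

/-- **The spliced process solves the SZZ system** (dyadic splicing time). [folklore] -/
theorem isSolution_splice (hW : IsFlatBrownian W P) (β : ℝ)
    (U : GaugeConfig 3 L (Matrix.specialUnitaryGroup (Fin 2) ℂ) → ℝ≥0 →
      {p : ℝ≥0 → (Edge 3 L × NoiseIdx 2 → ℝ) // Continuous p ∧ p 0 = 0} →
      GaugeConfig 3 L (Matrix.specialUnitaryGroup (Fin 2) ℂ))
    (hU0 : ∀ y p, U y 0 p = y)
    (hprog : ∀ i : ℝ≥0, Measurable[@Prod.instMeasurableSpace (Set.Iic i)
        (GaugeConfig 3 L (Matrix.specialUnitaryGroup (Fin 2) ℂ) ×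
          {p : ℝ≥0 → (Edge 3 L × NoiseIdx 2 → ℝ) // Continuous p ∧ p 0 = 0}) inferInstance
        (@Prod.instMeasurableSpace (GaugeConfig 3 L (Matrix.specialUnitaryGroup (Fin 2) ℂ))
          {p : ℝ≥0 → (Edge 3 L × NoiseIdx 2 → ℝ) // Continuous p ∧ p 0 = 0} inferInstance
          ((isFlatBrownian_canonical hW).natFiltration i))]
      (fun q : Set.Iic i × (GaugeConfig 3 L (Matrix.specialUnitaryGroup (Fin 2) ℂ) ×
        {p : ℝ≥0 → (Edge 3 L × NoiseIdx 2 → ℝ) // Continuous p ∧ p 0 = 0}) => U q.2.1 q.1 q.2.2))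
    {G : Set (GaugeConfig 3 L (Matrix.specialUnitaryGroup (Fin 2) ℂ) ×
      {p : ℝ≥0 → (Edge 3 L × NoiseIdx 2 → ℝ) // Continuous p ∧ p 0 = 0})} (hGm : MeasurableSet G)
    (hGc : ∀ q ∈ G, Continuous fun r => U q.1 r q.2)
    (hGae : ∀ y, ∀ᵐ q ∂(P.map (fun ω => (⟨fun t => W t ω, continuous_path_and_zero hW ω⟩ :
        {p : ℝ≥0 → (Edge 3 L × NoiseIdx 2 → ℝ) // Continuous p ∧ p 0 = 0}))), (y, q) ∈ G)
    (hsol : ∀ y, (latticeLangevinDynamics (fundamentalLatticeRep 2) β).IsSolution (fundamentalRep (Fin 2))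
      (isFlatBrownian_canonical hW).natFiltration
      (P.map (fun ω => (⟨fun t => W t ω, continuous_path_and_zero hW ω⟩ :
        {p : ℝ≥0 → (Edge 3 L × NoiseIdx 2 → ℝ) // Continuous p ∧ p 0 = 0})))
      (fun (t : ℝ≥0) (p : {p : ℝ≥0 → (Edge 3 L × NoiseIdx 2 → ℝ) // Continuous p ∧ p 0 = 0}) => p.1 t) (U y))
    (x : GaugeConfig 3 L (Matrix.specialUnitaryGroup (Fin 2) ℂ)) (k₀ m₀ : ℕ) :
    (latticeLangevinDynamics (fundamentalLatticeRep 2) β).IsSolution (fundamentalRep (Fin 2))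
      (isFlatBrownian_canonical hW).natFiltration
      (P.map (fun ω => (⟨fun t => W t ω, continuous_path_and_zero hW ω⟩ :
        {p : ℝ≥0 → (Edge 3 L × NoiseIdx 2 → ℝ) // Continuous p ∧ p 0 = 0})))
      (fun (t : ℝ≥0) (p : {p : ℝ≥0 → (Edge 3 L × NoiseIdx 2 → ℝ) // Continuous p ∧ p 0 = 0}) => p.1 t)
      (fun u p => (if u ≤ (k₀ : ℝ≥0) / 2 ^ m₀ then U x u p else U (U x ((k₀ : ℝ≥0) / 2 ^ m₀) p) (u - (k₀ : ℝ≥0) / 2 ^ m₀)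
        ⟨fun v => p.1 ((k₀ : ℝ≥0) / 2 ^ m₀ + v) - p.1 ((k₀ : ℝ≥0) / 2 ^ m₀),
          continuous_shiftPath_and_zero (isFlatBrownian_canonical hW) ((k₀ : ℝ≥0) / 2 ^ m₀) p⟩)) := by
  obtain ⟨K, hK⟩ := exists_spliceItoIntegrals hW β U hprog x k₀ m₀
  exact ⟨measurable_splice hW U hprog x _, ae_continuous_splice hW U hU0 hprog hGm hGc hGae x _, K, hK,
    spliceIdentity hW β U hU0 hprog hGm hGc hGae hsol x k₀ m₀ hK⟩

end Summit.QuantumFields.YangMills.Theorems.ColdStartUniversality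

end
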